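import Summits.QuantumFields.YangMills.Theorems.BalabanUVNodesN15CurvedGluingCubeDressedGeneralCommutator
import HarnessLib

/-!
# Route «BalabanUVNodes» (cluster K4 «SpineRates»), Track-A DAG node N15 = NE2, BACKGROUND LAYER — THE η-DEFECT OF THE DRESSED PERTURBATION's COMMUTATOR ROW `𝔇([𝒱′, M_{h′}]X′, [𝒱, M_h]X)`
# (FILE 55's `hDK` shape for the `𝒱`-half of the remainder row, decaying perturbation of the jet)

Cell `pub-ymgap`, seat `pub-ymgap-dag-n15-w3` (WIDTH SEAT 3∕3 on node N15, director-ym №197 ∕ HUMAN RULING D-0149; plan `W-SEAT-START-LIST.md` §n15 item 3 — twenty-eighth piece: the two-grid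
half of file 26).  `bears_on: R4∕N15 · K3⁷ SpineGivenEndpointR13SepCoPH (stmt-QuantumFields-20544)`.  Filed `--kind proof --supports stmt-QuantumFields-20544 --as helper` — COUNT-NEUTRAL.
Theorems only; 0 `sorry`.  Imports BY NAME file 26 `…N15CurvedGluingCubeDressedGeneralCommutator` (`commOp_dressedPert_comp_eq`; dag-n15-c FILE 56 `hasMaj_comm_nonlocal`, FILE 45 `hasMaj_comp_diag`∕
`hasMaj_diag_comp`, B2 `stack`∕`projO`∕`blkPair`∕`liftPair`∕`hasMaj_projO_comp`; lit `T4EtaRateDefect.idef`∕`idef_comp`∕`idef_add`∕`idef_sub`, `T4EtaRateCoeffDefect.hasMaj_idef_mulOp`,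
`hasMaj_comp_exp`); nothing in the tree is modified.

WHY.  FILE 55 asks the two-grid defect of every remainder row (`hDK`).  For the `𝒱`-half `[𝒱, M_h]∘X = C∘X̂ + V̂∘D_h∘X` (`C := V̂M_a − M_hV̂`, file 26) the Leibniz rule of `𝔇` across compositions
reduces it to: the TWISTED two-carrier defect `𝔇(C′, C) = (𝔇(V̂′,V̂)M_a − M_{h′}𝔇(V̂′,V̂)) + (V̂′𝔇(M_{a′},M_a) − 𝔇(M_{h′},M_h)V̂)` — FILE 56's nonlocal commutator letter for `T = 𝔇(V̂′, V̂) ≤ oe^{−δ_Vd}`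
plus the partition's fits `|a′ − a∘π̂| ≤ o_a`, `|h′ − h∘π̃| ≤ o_h` against `V̂, V̂′ ≤ Re^{−δ_Vd}` (exactly FILE 56 `hasMaj_idef_commOp_nonlocal`'s proof, two carriers) — and the pair's letters
(`X̂ ≤ A`, `𝔇(X̂′, X̂) ≤ A_D`: files 23–24), the Leibniz remainders `D_h ≤ diagK c₁`, `𝔇(D′_h, D_h) ≤ diagK o_D`.

* §1 `idef_twistedComm_eq` (exact), ★★ `hasMaj_idef_twistedComm` (`≤ ((ℓ(eε)⁻¹ + 2ω)o + 2Ro_*)e^{−(δ_V−ε)d}`-type letter, `o_* = max fit`);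
* §2 `idef_commRow_eq` (exact Leibniz split of the row defect), ★★ `hasMaj_idef_commRow` (its letter at rate `ρ₃`, all pair letters displayed);
* §3 ★★ `hasMaj_idef_commOp_dressedPert_comp` (BY NAME on `𝔇([𝒱′, M_{h′}]∘X′, [𝒱, M_h]∘X)` via file 26's exact split at both grids).

HONEST FRAMING ∕ LIMITS.  Finite-dimensional defect bookkeeping over DISPLAYED letters (perturbation decay∕fit, partition `ℓ, ω, o_a, o_h, c₁, o_D`, pair `A, A_D`); nothing of [B5]∕[B9] asserted
((1.120)–(1.128) pp. 37–38, (3.63)–(3.65), (3.76)–(3.77), Thm 3.14 = SHAPES ∕ MECHANISM ∕ TEMPLATE).  NE2⁺ NOT PRINTED, NOT proved; N15 NOT discharged; counts of record UNMOVED (typed 28∕28 ·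
discharged 5∕27); one finite 𝕋⁴ at fixed ε — NOT infinite volume, NOT OS on ℝ⁴, NOT a mass gap, NOT Clay; R4 closes the conditional finite-𝕋⁴ rung `BalabanLadder.UV` only.  Restate-immune.
-/

set_option autoImplicit false

noncomputable section
open scoped BigOperators
open Finset

namespace Summit.QuantumFields.YangMills.BalabanUVNodes.N15.CurvedSpecies

open Literature.MathematicalPhysics.QuantumFieldTheory.Balaban1983to89
open Literature.MathematicalPhysics.QuantumFieldTheory.Balaban1983to89.B11SectG (BlockNorm HasMaj RowSum hasMaj_comp_exp)
open Literature.MathematicalPhysics.QuantumFieldTheory.Balaban1983to89.B6RandomWalk (Triangle254)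
open Literature.MathematicalPhysics.QuantumFieldTheory.Balaban1983to89.T4EtaRateDefect (idef idef_apply idef_comp idef_add idef_sub)
open Literature.MathematicalPhysics.QuantumFieldTheory.Balaban1983to89.T4EtaRateCoeffDefect (pull pull_apply diagK diagK_nonneg hasMaj_idef_mulOp)
open Literature.MathematicalPhysics.QuantumFieldTheory.Balaban1983to89.B6Prop26Gluing (mulOp mulOp_apply ind ind_nonneg ind_of_mem)
open Summit.QuantumFields.YangMills.BalabanUVNodes.N15.MatrixSpecies (liftBlk liftMap)
open Summit.QuantumFields.YangMills.BalabanUVNodes.N15.BackgroundModel (kappa_ofBlocks)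
open Summit.QuantumFields.YangMills.BalabanUVNodes.N15.BackgroundLayer (stack projO blkPair liftPair hasMaj_projO_comp bgPropV)
open Summit.QuantumFields.YangMills.BalabanUVNodes.N15.Gluing (commOp hasMaj_comp_diag hasMaj_diag_comp hasMaj_comm_nonlocal)

variable {X X' ι J : Type} [Fintype X] [Fintype X'] [DecidableEq X] [DecidableEq X'] [Fintype ι] [DecidableEq ι] [Fintype J] [DecidableEq J] {g : B6.Geometry}
  (blk : X → g.Site) (π : X' → X) {σ cr : ℝ}
  {V : ((X × ι) × Option (J ⊕ J) → ℝ) →ₗ[ℝ] (X × ι → ℝ)} {V' : ((X' × ι) × Option (J ⊕ J) → ℝ) →ₗ[ℝ] (X' × ι → ℝ)}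
  {a : (X × ι) × Option (J ⊕ J) → ℝ} {a' : (X' × ι) × Option (J ⊕ J) → ℝ} {h : X × ι → ℝ} {h' : X' × ι → ℝ}

/-! ## §1 The twisted two-carrier commutator's defect -/

omit [Fintype X] [Fintype X'] [DecidableEq X] [DecidableEq X'] [Fintype ι] [DecidableEq ι] [Fintype J] [DecidableEq J] in
/-- EXACT: `𝔇(V̂′M_{a′} − M_{h′}V̂′, V̂M_a − M_hV̂) = (𝔇(V̂′,V̂)∘M_a − M_{h′}∘𝔇(V̂′,V̂)) + (V̂′∘𝔇(M_{a′},M_a) − 𝔇(M_{h′},M_h)∘V̂)`. [folklore] -/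
theorem idef_twistedComm_eq :
    idef (pull (liftPair (liftMap π ι))) (pull (liftMap π ι)) (V' ∘ₗ mulOp a' - mulOp h' ∘ₗ V') (V ∘ₗ mulOp a - mulOp h ∘ₗ V) =
      (idef (pull (liftPair (liftMap π ι))) (pull (liftMap π ι)) V' V ∘ₗ mulOp a - mulOp h' ∘ₗ idef (pull (liftPair (liftMap π ι))) (pull (liftMap π ι)) V' V) +
        (V' ∘ₗ idef (pull (liftPair (liftMap π ι))) (pull (liftPair (liftMap π ι))) (mulOp a') (mulOp a) -
          idef (pull (liftMap π ι)) (pull (liftMap π ι)) (mulOp h') (mulOp h) ∘ₗ V) := by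
  rw [idef_sub, idef_comp (pull (liftPair (liftMap π ι))) (pull (liftPair (liftMap π ι))) (pull (liftMap π ι)),
    idef_comp (pull (liftPair (liftMap π ι))) (pull (liftMap π ι)) (pull (liftMap π ι))]
  abel

omit [DecidableEq X] [DecidableEq X'] [DecidableEq ι] [DecidableEq J] in
/-- ★★ **THE TWISTED COMMUTATOR's DEFECT LETTER**: `𝔇(V̂′, V̂) ≤ oe^{−δ_Vd}`, `V̂, V̂′ ≤ Re^{−δ_Vd}`, multipliers `a` (coarse jet) and `h′` (fine base) within `ω` of a block-constant `hb` with
block-Lipschitz `ℓ`, fits `|a′ − a∘π̂| ≤ o_*`, `|h′ − h∘π̃| ≤ o_*`, `ε > 0` ⟹ `≤ ((ℓ(eε)⁻¹ + 2ω)o + 2Ro_*)e^{−(δ_V−ε)d}` (FILE 56 `hasMaj_idef_commOp_nonlocal`, two carriers).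
[cite: Balaban1984PropagatorsI, (1.120) p.37, (1.128) p.38 (mechanism); Balaban1985BackgroundPropagators, Thm 3.14 pp.426–427 (template)] -/
theorem hasMaj_idef_twistedComm {R o ℓ ω oo ε δV : ℝ} {hb : g.Site → ℝ} (hR : 0 ≤ R) (ho : 0 ≤ o) (hℓ : 0 ≤ ℓ) (hω : 0 ≤ ω) (hoo : 0 ≤ oo) (hε : 0 < ε)
    (hd : ∀ y y', 0 ≤ g.dist y y') (hsymm : ∀ y y', g.dist y y' = g.dist y' y) (hLip : ∀ y y', |hb y - hb y'| ≤ ℓ * g.dist y y')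
    (hra : ∀ q, |a q - hb (blkPair (liftBlk blk ι) q)| ≤ ω) (hrh' : ∀ p', |h' p' - hb (liftBlk (blk ∘ π) ι p')| ≤ ω)
    (hfa : ∀ q', |a' q' - a (liftPair (liftMap π ι) q')| ≤ oo) (hfh : ∀ p', |h' p' - h (liftMap π ι p')| ≤ oo)
    (hV : HasMaj (BlockNorm.ofBlocks g (blkPair (liftBlk blk ι))) (BlockNorm.ofBlocks g (liftBlk blk ι)) V (fun y y' => R * Real.exp (-(δV * g.dist y y'))))
    (hV' : HasMaj (BlockNorm.ofBlocks g (blkPair (liftBlk (blk ∘ π) ι))) (BlockNorm.ofBlocks g (liftBlk (blk ∘ π) ι)) V' (fun y y' => R * Real.exp (-(δV * g.dist y y'))))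
    (hDV : HasMaj (BlockNorm.ofBlocks g (blkPair (liftBlk blk ι))) (BlockNorm.ofBlocks g (liftBlk (blk ∘ π) ι))
      (idef (pull (liftPair (liftMap π ι))) (pull (liftMap π ι)) V' V) (fun y y' => o * Real.exp (-(δV * g.dist y y')))) :
    HasMaj (BlockNorm.ofBlocks g (blkPair (liftBlk blk ι))) (BlockNorm.ofBlocks g (liftBlk (blk ∘ π) ι))
      (idef (pull (liftPair (liftMap π ι))) (pull (liftMap π ι)) (V' ∘ₗ mulOp a' - mulOp h' ∘ₗ V') (V ∘ₗ mulOp a - mulOp h ∘ₗ V))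
      (fun y y' => ((ℓ * (Real.exp 1 * ε)⁻¹ + 2 * ω) * o + 2 * R * oo) * Real.exp (-((δV - ε) * g.dist y y'))) := by
  have t1 := hasMaj_comm_nonlocal (blkPair (liftBlk blk ι)) (liftBlk (blk ∘ π) ι) (h := a) (h' := h') ho hℓ hω hε hd hsymm hLip hra hrh' hDV
  have hDMa := hasMaj_idef_mulOp (g := g) (blkPair (liftBlk blk ι)) (liftPair (liftMap π ι)) (o := fun _ => oo) (fun _ => hoo) hfa
  have hDMh := hasMaj_idef_mulOp (g := g) (liftBlk blk ι) (liftMap π ι) (o := fun _ => oo) (fun _ => hoo) hfh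
  have hKnn : ∀ y y' : g.Site, 0 ≤ R * Real.exp (-(δV * g.dist y y')) := fun y y' => mul_nonneg hR (Real.exp_nonneg _)
  have t2 := hasMaj_comp_diag (blkPair (liftBlk (blk ∘ π) ι)) hKnn hV' hDMa
  have t3 := hasMaj_diag_comp (liftBlk blk ι) (fun _ => hoo) hDMh hV
  rw [idef_twistedComm_eq]
  refine (t1.add (t2.sub t3)).mono fun y y' => ?_
  have hexp : Real.exp (-(δV * g.dist y y')) ≤ Real.exp (-((δV - ε) * g.dist y y')) := Real.exp_le_exp.2 (by nlinarith [hd y y', hε.le])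
  have h2 : R * Real.exp (-(δV * g.dist y y')) * oo + oo * (R * Real.exp (-(δV * g.dist y y'))) ≤ 2 * R * oo * Real.exp (-((δV - ε) * g.dist y y')) := by
    nlinarith [mul_le_mul_of_nonneg_left hexp (mul_nonneg hR hoo)]
  calc (ℓ * (Real.exp 1 * ε)⁻¹ + 2 * ω) * o * Real.exp (-((δV - ε) * g.dist y y')) + (R * Real.exp (-(δV * g.dist y y')) * oo + oo * (R * Real.exp (-(δV * g.dist y y'))))
      ≤ (ℓ * (Real.exp 1 * ε)⁻¹ + 2 * ω) * o * Real.exp (-((δV - ε) * g.dist y y')) + 2 * R * oo * Real.exp (-((δV - ε) * g.dist y y')) := by linarith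
    _ = _ := by ring

/-! ## §2 The row defect: Leibniz split and letter -/

variable {Xh : (X × ι → ℝ) →ₗ[ℝ] ((X × ι) × Option (J ⊕ J) → ℝ)} {Xh' : (X' × ι → ℝ) →ₗ[ℝ] ((X' × ι) × Option (J ⊕ J) → ℝ)}
  {Dh : (X × ι → ℝ) →ₗ[ℝ] ((X × ι) × Option (J ⊕ J) → ℝ)} {Dh' : (X' × ι → ℝ) →ₗ[ℝ] ((X' × ι) × Option (J ⊕ J) → ℝ)}

omit [Fintype X] [Fintype X'] [DecidableEq X] [DecidableEq X'] [Fintype ι] [DecidableEq ι] [Fintype J] [DecidableEq J] in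
/-- EXACT: the Leibniz split of `𝔇(C′X̂′ + V̂′D′_hX′, CX̂ + V̂D_hX)` (`X = pr₀X̂`): `C′𝔇(X̂′,X̂) + 𝔇(C′,C)X̂ + V̂′(D′_h𝔇(X′,X) + 𝔇(D′_h,D_h)X) + 𝔇(V̂′,V̂)D_hX`. [folklore] -/
theorem idef_commRow_eq (C : ((X × ι) × Option (J ⊕ J) → ℝ) →ₗ[ℝ] (X × ι → ℝ)) (C' : ((X' × ι) × Option (J ⊕ J) → ℝ) →ₗ[ℝ] (X' × ι → ℝ)) :
    idef (pull (liftMap π ι)) (pull (liftMap π ι)) (C' ∘ₗ Xh' + V' ∘ₗ Dh' ∘ₗ (projO none ∘ₗ Xh')) (C ∘ₗ Xh + V ∘ₗ Dh ∘ₗ (projO none ∘ₗ Xh)) =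
      C' ∘ₗ idef (pull (liftMap π ι)) (pull (liftPair (liftMap π ι))) Xh' Xh + idef (pull (liftPair (liftMap π ι))) (pull (liftMap π ι)) C' C ∘ₗ Xh +
        (V' ∘ₗ (Dh' ∘ₗ idef (pull (liftMap π ι)) (pull (liftMap π ι)) (projO none ∘ₗ Xh') (projO none ∘ₗ Xh) +
            idef (pull (liftMap π ι)) (pull (liftPair (liftMap π ι))) Dh' Dh ∘ₗ (projO none ∘ₗ Xh)) +
          idef (pull (liftPair (liftMap π ι))) (pull (liftMap π ι)) V' V ∘ₗ (Dh ∘ₗ (projO none ∘ₗ Xh))) := by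
  rw [idef_add, idef_comp (pull (liftMap π ι)) (pull (liftPair (liftMap π ι))) (pull (liftMap π ι)) C' Xh' C Xh,
    idef_comp (pull (liftMap π ι)) (pull (liftPair (liftMap π ι))) (pull (liftMap π ι)) V' (Dh' ∘ₗ (projO none ∘ₗ Xh')) V (Dh ∘ₗ (projO none ∘ₗ Xh)),
    idef_comp (pull (liftMap π ι)) (pull (liftMap π ι)) (pull (liftPair (liftMap π ι))) Dh' (projO none ∘ₗ Xh') Dh (projO none ∘ₗ Xh)]

omit [DecidableEq X] [DecidableEq X'] [DecidableEq ι] [DecidableEq J] in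
/-- ★★ **THE ROW DEFECT's LETTER** (pair letters displayed): `C′ ≤ Le^{−(δ_V−ε)d}`, `𝔇(C′,C) ≤ L_De^{−(δ_V−ε)d}`, `X̂ ≤ Ae^{−ρ₂d}`, `𝔇(X̂′,X̂) ≤ A_De^{−ρ₂d}`, `V̂′ ≤ Re^{−δ_Vd}`, `𝔇(V̂′,V̂) ≤ oe^{−δ_Vd}`,
`D_h, D′_h ≤ diagK c₁`, `𝔇(D′_h, D_h) ≤ diagK o_D`, rates `ρ₃ ≤ ρ₂`, `ρ₃ + σ ≤ δ_V − ε`, `ε ≤ δ_V`... ⟹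
`≤ (L·A_D + L_D·A + R·(c₁A_D + o_DA) + o·c₁·A)·c_r·e^{−ρ₃d}`. [cite: Balaban1985BackgroundPropagators, Thm 3.14 pp.426–427 (template); Balaban1984PropagatorsII, (2.52)–(2.56)] -/
theorem hasMaj_idef_commRow (htri : Triangle254 g) (hd : ∀ a b : g.Site, 0 ≤ g.dist a b) (hrow : RowSum g σ cr) {ρ₂ ρ₃ δV ε R o L LD A AD c₁ oD : ℝ} (hR : 0 ≤ R) (ho : 0 ≤ o)
    (hL : 0 ≤ L) (hLD : 0 ≤ LD) (hA : 0 ≤ A) (hAD : 0 ≤ AD) (hc₁ : 0 ≤ c₁) (hoD : 0 ≤ oD) (hε : 0 ≤ ε) (hρ₃ : 0 ≤ ρ₃) (hρ₃₂ : ρ₃ ≤ ρ₂) (hρ₃V : ρ₃ + σ ≤ δV - ε)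
    {C : ((X × ι) × Option (J ⊕ J) → ℝ) →ₗ[ℝ] (X × ι → ℝ)} {C' : ((X' × ι) × Option (J ⊕ J) → ℝ) →ₗ[ℝ] (X' × ι → ℝ)}
    (hC' : HasMaj (BlockNorm.ofBlocks g (blkPair (liftBlk (blk ∘ π) ι))) (BlockNorm.ofBlocks g (liftBlk (blk ∘ π) ι)) C' (fun y y' => L * Real.exp (-((δV - ε) * g.dist y y'))))
    (hDC : HasMaj (BlockNorm.ofBlocks g (blkPair (liftBlk blk ι))) (BlockNorm.ofBlocks g (liftBlk (blk ∘ π) ι)) (idef (pull (liftPair (liftMap π ι))) (pull (liftMap π ι)) C' C)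
      (fun y y' => LD * Real.exp (-((δV - ε) * g.dist y y'))))
    (hX : HasMaj (BlockNorm.ofBlocks g (liftBlk blk ι)) (BlockNorm.ofBlocks g (blkPair (liftBlk blk ι))) Xh (fun y y' => A * Real.exp (-(ρ₂ * g.dist y y'))))
    (hDX : HasMaj (BlockNorm.ofBlocks g (liftBlk blk ι)) (BlockNorm.ofBlocks g (blkPair (liftBlk (blk ∘ π) ι))) (idef (pull (liftMap π ι)) (pull (liftPair (liftMap π ι))) Xh' Xh)
      (fun y y' => AD * Real.exp (-(ρ₂ * g.dist y y'))))
    (hV' : HasMaj (BlockNorm.ofBlocks g (blkPair (liftBlk (blk ∘ π) ι))) (BlockNorm.ofBlocks g (liftBlk (blk ∘ π) ι)) V' (fun y y' => R * Real.exp (-(δV * g.dist y y'))))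
    (hDV : HasMaj (BlockNorm.ofBlocks g (blkPair (liftBlk blk ι))) (BlockNorm.ofBlocks g (liftBlk (blk ∘ π) ι))
      (idef (pull (liftPair (liftMap π ι))) (pull (liftMap π ι)) V' V) (fun y y' => o * Real.exp (-(δV * g.dist y y'))))
    (hDh : HasMaj (BlockNorm.ofBlocks g (liftBlk blk ι)) (BlockNorm.ofBlocks g (blkPair (liftBlk blk ι))) Dh (diagK fun _ => c₁))
    (hDh' : HasMaj (BlockNorm.ofBlocks g (liftBlk (blk ∘ π) ι)) (BlockNorm.ofBlocks g (blkPair (liftBlk (blk ∘ π) ι))) Dh' (diagK fun _ => c₁))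
    (hDDh : HasMaj (BlockNorm.ofBlocks g (liftBlk blk ι)) (BlockNorm.ofBlocks g (blkPair (liftBlk (blk ∘ π) ι))) (idef (pull (liftMap π ι)) (pull (liftPair (liftMap π ι))) Dh' Dh)
      (diagK fun _ => oD)) :
    HasMaj (BlockNorm.ofBlocks g (liftBlk blk ι)) (BlockNorm.ofBlocks g (liftBlk (blk ∘ π) ι))
      (idef (pull (liftMap π ι)) (pull (liftMap π ι)) (C' ∘ₗ Xh' + V' ∘ₗ Dh' ∘ₗ (projO none ∘ₗ Xh')) (C ∘ₗ Xh + V ∘ₗ Dh ∘ₗ (projO none ∘ₗ Xh)))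
      (fun y y' => (L * AD + LD * A + R * (c₁ * AD + oD * A) + o * c₁ * A) * cr * Real.exp (-(ρ₃ * g.dist y y'))) := by
  have hρ₃V' : ρ₃ + σ ≤ δV := by linarith
  -- the five pieces at rate `ρ₃`
  have p1 := hasMaj_comp_exp htri hd hrow hL hAD hρ₃ hρ₃₂ hρ₃V hC' hDX
  have p2 := hasMaj_comp_exp htri hd hrow hLD hA hρ₃ hρ₃₂ hρ₃V hDC hX
  have hX0 := hasMaj_projO_comp (liftBlk blk ι) hX none
  have hDX0 : HasMaj (BlockNorm.ofBlocks g (liftBlk blk ι)) (BlockNorm.ofBlocks g (liftBlk (blk ∘ π) ι))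
      (idef (pull (liftMap π ι)) (pull (liftMap π ι)) (projO none ∘ₗ Xh') (projO none ∘ₗ Xh)) (fun y y' => AD * Real.exp (-(ρ₂ * g.dist y y'))) := by
    have hcomp : idef (pull (liftMap π ι)) (pull (liftMap π ι)) (projO none ∘ₗ Xh') (projO none ∘ₗ Xh) =
        projO none ∘ₗ idef (pull (liftMap π ι)) (pull (liftPair (liftMap π ι))) Xh' Xh := LinearMap.ext fun v => funext fun x' => rfl
    rw [hcomp]; exact hasMaj_projO_comp (liftBlk (blk ∘ π) ι) hDX none
  -- `D′_h∘𝔇(X′,X) ≤ c₁·A_D e^{−ρ₂d}`, `𝔇(D′_h,D_h)∘X ≤ o_D·A e^{−ρ₂d}`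
  have q1 : HasMaj (BlockNorm.ofBlocks g (liftBlk blk ι)) (BlockNorm.ofBlocks g (blkPair (liftBlk (blk ∘ π) ι)))
      (Dh' ∘ₗ idef (pull (liftMap π ι)) (pull (liftMap π ι)) (projO none ∘ₗ Xh') (projO none ∘ₗ Xh) + idef (pull (liftMap π ι)) (pull (liftPair (liftMap π ι))) Dh' Dh ∘ₗ (projO none ∘ₗ Xh))
      (fun y y' => (c₁ * AD + oD * A) * Real.exp (-(ρ₂ * g.dist y y'))) := by
    have u1 := hasMaj_diag_comp (liftBlk (blk ∘ π) ι) (fun _ => hc₁) hDh' hDX0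
    have u2 := hasMaj_diag_comp (liftBlk blk ι) (fun _ => hoD) hDDh hX0
    refine (u1.add u2).mono fun y y' => le_of_eq ?_
    ring
  have p3 := hasMaj_comp_exp htri hd hrow hR (by positivity : 0 ≤ c₁ * AD + oD * A) hρ₃ hρ₃₂ hρ₃V' hV' q1
  -- `𝔇(V̂′,V̂)∘(D_h∘X) ≤ o·(c₁A)·c_r e^{−ρ₃d}`
  have q2 : HasMaj (BlockNorm.ofBlocks g (liftBlk blk ι)) (BlockNorm.ofBlocks g (blkPair (liftBlk blk ι))) (Dh ∘ₗ (projO none ∘ₗ Xh)) (fun y y' => c₁ * A * Real.exp (-(ρ₂ * g.dist y y'))) := by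
    refine (hasMaj_diag_comp (liftBlk blk ι) (fun _ => hc₁) hDh hX0).mono fun y y' => le_of_eq ?_
    ring
  have p4 := hasMaj_comp_exp htri hd hrow ho (mul_nonneg hc₁ hA) hρ₃ hρ₃₂ hρ₃V' hDV q2
  rw [idef_commRow_eq]
  refine ((p1.add p2).add ((p3).add p4)).mono fun y y' => le_of_eq ?_
  simp only [kappa_ofBlocks]
  ring

/-! ## §3 By name on the dressed perturbation's commutator row -/

variable {G₀ : (X × ι → ℝ) →ₗ[ℝ] (X × ι → ℝ)} {D Dq : J ⊕ J → (X × ι → ℝ) →ₗ[ℝ] (X × ι → ℝ)} {G₀' : (X' × ι → ℝ) →ₗ[ℝ] (X' × ι → ℝ)}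
  {D' Dq' : J ⊕ J → (X' × ι → ℝ) →ₗ[ℝ] (X' × ι → ℝ)}

/-- ★★ **THE η-DEFECT OF `[𝒱, M_h]∘X`** (FILE 55's `hDK` shape for the `𝒱`-half of the remainder row): with the jets' Leibniz identities at both grids and the letters of `hasMaj_idef_commRow` (the pair
`X̂ = (1 − ŜV̂)⁻¹Ŝ` and its defect from files 23–24, the twisted commutator's from §1, FILE 56's `C′` letter):
`𝔇([𝒱′, M_{h′}]∘X′, [𝒱, M_h]∘X) ≤ (L·A_D + L_D·A + R(c₁A_D + o_DA) + oc₁A)c_r·e^{−ρ₃d}`. [cite: Balaban1985BackgroundPropagators, Thm 3.14 pp.426–427 (template); Balaban1984PropagatorsI, (1.128) p.38] -/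
theorem hasMaj_idef_commOp_dressedPert_comp (htri : Triangle254 g) (hd : ∀ a b : g.Site, 0 ≤ g.dist a b) (hrow : RowSum g σ cr) {ρ₂ ρ₃ δV ε R o L LD A AD c₁ oD : ℝ}
    (hR : 0 ≤ R) (ho : 0 ≤ o) (hL : 0 ≤ L) (hLD : 0 ≤ LD) (hA : 0 ≤ A) (hAD : 0 ≤ AD) (hc₁ : 0 ≤ c₁) (hoD : 0 ≤ oD) (hε : 0 ≤ ε) (hρ₃ : 0 ≤ ρ₃) (hρ₃₂ : ρ₃ ≤ ρ₂)
    (hρ₃V : ρ₃ + σ ≤ δV - ε)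
    (hjet : stack LinearMap.id Dq ∘ₗ mulOp h = mulOp a ∘ₗ stack LinearMap.id Dq + Dh) (hjet' : stack LinearMap.id Dq' ∘ₗ mulOp h' = mulOp a' ∘ₗ stack LinearMap.id Dq' + Dh')
    (hDq : ∀ j, D j = Dq j ∘ₗ G₀) (hDq' : ∀ j, D' j = Dq' j ∘ₗ G₀') (hunit : IsUnit (1 - LinearMap.toMatrix' (stack G₀ D ∘ₗ V)))
    (hunit' : IsUnit (1 - LinearMap.toMatrix' (stack G₀' D' ∘ₗ V')))
    (hC' : HasMaj (BlockNorm.ofBlocks g (blkPair (liftBlk (blk ∘ π) ι))) (BlockNorm.ofBlocks g (liftBlk (blk ∘ π) ι)) (V' ∘ₗ mulOp a' - mulOp h' ∘ₗ V')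
      (fun y y' => L * Real.exp (-((δV - ε) * g.dist y y'))))
    (hDC : HasMaj (BlockNorm.ofBlocks g (blkPair (liftBlk blk ι))) (BlockNorm.ofBlocks g (liftBlk (blk ∘ π) ι))
      (idef (pull (liftPair (liftMap π ι))) (pull (liftMap π ι)) (V' ∘ₗ mulOp a' - mulOp h' ∘ₗ V') (V ∘ₗ mulOp a - mulOp h ∘ₗ V)) (fun y y' => LD * Real.exp (-((δV - ε) * g.dist y y'))))
    (hX : HasMaj (BlockNorm.ofBlocks g (liftBlk blk ι)) (BlockNorm.ofBlocks g (blkPair (liftBlk blk ι))) (bgPropV (stack G₀ D) V) (fun y y' => A * Real.exp (-(ρ₂ * g.dist y y'))))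
    (hDX : HasMaj (BlockNorm.ofBlocks g (liftBlk blk ι)) (BlockNorm.ofBlocks g (blkPair (liftBlk (blk ∘ π) ι)))
      (idef (pull (liftMap π ι)) (pull (liftPair (liftMap π ι))) (bgPropV (stack G₀' D') V') (bgPropV (stack G₀ D) V)) (fun y y' => AD * Real.exp (-(ρ₂ * g.dist y y'))))
    (hV' : HasMaj (BlockNorm.ofBlocks g (blkPair (liftBlk (blk ∘ π) ι))) (BlockNorm.ofBlocks g (liftBlk (blk ∘ π) ι)) V' (fun y y' => R * Real.exp (-(δV * g.dist y y'))))
    (hDV : HasMaj (BlockNorm.ofBlocks g (blkPair (liftBlk blk ι))) (BlockNorm.ofBlocks g (liftBlk (blk ∘ π) ι))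
      (idef (pull (liftPair (liftMap π ι))) (pull (liftMap π ι)) V' V) (fun y y' => o * Real.exp (-(δV * g.dist y y'))))
    (hDh : HasMaj (BlockNorm.ofBlocks g (liftBlk blk ι)) (BlockNorm.ofBlocks g (blkPair (liftBlk blk ι))) Dh (diagK fun _ => c₁))
    (hDh' : HasMaj (BlockNorm.ofBlocks g (liftBlk (blk ∘ π) ι)) (BlockNorm.ofBlocks g (blkPair (liftBlk (blk ∘ π) ι))) Dh' (diagK fun _ => c₁))
    (hDDh : HasMaj (BlockNorm.ofBlocks g (liftBlk blk ι)) (BlockNorm.ofBlocks g (blkPair (liftBlk (blk ∘ π) ι))) (idef (pull (liftMap π ι)) (pull (liftPair (liftMap π ι))) Dh' Dh)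
      (diagK fun _ => oD)) :
    HasMaj (BlockNorm.ofBlocks g (liftBlk blk ι)) (BlockNorm.ofBlocks g (liftBlk (blk ∘ π) ι))
      (idef (pull (liftMap π ι)) (pull (liftMap π ι)) (commOp (V' ∘ₗ stack LinearMap.id Dq') h' ∘ₗ (projO none ∘ₗ bgPropV (stack G₀' D') V'))
        (commOp (V ∘ₗ stack LinearMap.id Dq) h ∘ₗ (projO none ∘ₗ bgPropV (stack G₀ D) V)))
      (fun y y' => (L * AD + LD * A + R * (c₁ * AD + oD * A) + o * c₁ * A) * cr * Real.exp (-(ρ₃ * g.dist y y'))) := by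
  rw [commOp_dressedPert_comp_eq hjet hDq hunit, commOp_dressedPert_comp_eq hjet' hDq' hunit']
  exact hasMaj_idef_commRow blk π htri hd hrow hR ho hL hLD hA hAD hc₁ hoD hε hρ₃ hρ₃₂ hρ₃V hC' hDC hX hDX hV' hDV hDh hDh' hDDh

end Summit.QuantumFields.YangMills.BalabanUVNodes.N15.CurvedSpecies

end
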